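import Summits.HodgeConjecture.CorCM.IrreducibleOddWeightsCommutantDensityMeet
import HarnessLib

/-!
# Density over the commutant, XIII: FINITELY MANY PIVOTS AT ONCE — `⨆_s S(w_s) = S(⊔_s w_s)` on the disjoint-union
# pivot, `dim(⨆_s S(w_s))·δ = dim(⨆_s D⟨b^s⟩)·dim A`, absorption `S(w) ≤ ⨆_s S(w_s) ⟺ D⟨b⟩ ≤ ⨆_s D⟨b^s⟩`

COR-CM (cell `pub-hodgecm2`, binder seat `b16` gen 74, count-neutral claim SUB-FAMILY DOMINATION AND HODGE
EQUIVALENCE, file S3 — abstract `G`-set level; theorems only, no definition, no named fact, no `sorry`).  NEW as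
stated, hence under `Summits/`.  HONEST FRAMING: linear algebra of translates of functions on finite `G`-sets; gen 72's
files C4/C6 (`…CommutantDensityShadows`, `…CommutantDensityMeet`) count ONE or TWO pivots, this file juxtaposes a
FINITE FAMILY of pivots `(Y_s)_{s ∈ S}` on their disjoint union `⊔_s Y_s` (Mathlib's `Sigma` action; the tree's
extension by zero `slotExt`, assembly `sigmaLift`) — the device of C4 §2 (`Y₀ ⊕ Y₁`) for any finite `S`.  Nothing
about Hodge classes is asserted; the CM reading (a whole family of CM types inside ONE isotypic class) is file S4.

SETTING (gen 72): one reference `G`-stable IRREDUCIBLE `A ≤ ℚ^Y` with commutant `𝒟` (ANY; a parameter with its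
characterising hypothesis `h𝒟`), D-lines `D·a = 𝒟.map (applyₗ a)`, D-spans `D⟨b⟩ = ⨆_j D·b_j`, `δ = dim D·a₀`
(`0 ≠ a₀ ∈ A`); for each `s ∈ S` a finite pivot `Y_s`, equivariant embeddings `ι^s_j : A → ℚ^{Y_s}` (`j ∈ J_s`)
jointly independent on `A`, components `b^s_j ∈ A`, the shadow `w_s = Σ_j ι^s_j(b^s_j)` and its coefficient space
`S(w_s) = span{g ↦ w_s(g·y) : y ∈ Y_s} ≤ ℚ^G`.

* §1 THE DISJOINT-UNION PIVOT: the combined embeddings `(s, j) ↦ slotExt s ∘ ι^s_j` into `ℚ^{⊔_s Y_s}` are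
  equivariant (`slotExt_comp_apply_translate`) and jointly independent (`sigma_jointly_independent`); the combined
  shadow is `sigmaLift (w_s)_s` (`sum_sigma_slotExt_comp_apply`); **`span_shadowCoeff_sigmaLift_eq_iSup`:
  `S(⊔_s w_s) = ⨆_s S(w_s)`** (any vectors `w_s`); `iSup_sigma_map_applyₗ`: `D⟨(b^s_j)_{(s,j)}⟩ = ⨆_s D⟨b^s⟩`.
* §2 COUNTS: **`finrank_iSup_span_shadowCoeff_mul_eq`: `dim(⨆_s S(w_s))·δ = dim(⨆_s D⟨b^s⟩)·dim A`**, D-rank form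
  `exists_rank_finrank_iSup_span_shadowCoeff_eq` (`∃ r ≤ Σ_s |J_s|`, `dim ⨆_s D⟨b^s⟩ = r·δ`, `dim ⨆_s S(w_s) = r·dim A`);
  against one more pivot `Y′` with shadow `w′ = Σ_k ι′_k(b′_k)`: **`finrank_iSup_span_shadowCoeff_inf_mul_eq`:
  `dim((⨆_s S(w_s)) ∩ S(w′))·δ = dim((⨆_s D⟨b^s⟩) ∩ D⟨b′⟩)·dim A`**, `…_inf_eq_bot_iff`.
* §3 ABSORPTION: **`span_shadowCoeff_le_iSup_iff_iSup_le`: `S(w′) ≤ ⨆_s S(w_s) ⟺ D⟨b′⟩ ≤ ⨆_s D⟨b^s⟩`** (`A ≠ 0`) —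
  `w′` is absorbed by the family iff its components are `D`-combinations of ALL the `b^s_j`; family-by-family
  `iSup_span_shadowCoeff_le_iSup_iff` and `iSup_span_shadowCoeff_eq_iSup_iff`.

## References

* [Lang2002] S. Lang, *Algebra*, 3rd ed., XVII §1 (modules over the commutant), XVII §3 (density).
* [Serre1977] J.-P. Serre, *Linear Representations of Finite Groups*, GTM 42, §2.6 (canonical decomposition).
* [Gordon1999HodgeAVSurvey] B. B. Gordon, *A survey of the Hodge conjecture for abelian varieties*, §3 Theorem (proof),
  7.5–7.7, 9.4.3.
-/

set_option autoImplicit false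

noncomputable section

open scoped BigOperators Classical

universe u u' uS v v' v'' w

namespace Summit.HodgeConjecture.CorCM.IrrOdd

open Literature.NumberTheory.ComplexMultiplication

variable {G : Type w} [Group G] {Y : Type v} [MulAction G Y] [Fintype Y]
  {S : Type uS} [Fintype S] {Yf : S → Type v'} [∀ s, MulAction G (Yf s)] [∀ s, Fintype (Yf s)]
  {Jf : S → Type u} [∀ s, Fintype (Jf s)]
  {Y₁ : Type v''} [MulAction G Y₁] [Fintype Y₁]

/-! ### §1 The disjoint-union pivot `⊔_s Y_s` -/

omit [Fintype Y] [Fintype S] [∀ s, Fintype (Yf s)] [∀ s, Fintype (Jf s)] in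
/-- The combined embedding `slotExt s ∘ ι^s_j : A → ℚ^{⊔_s Y_s}` is equivariant on `A` when `ι^s_j` is
(`g·(s, y) = (s, g·y)`). [cite: Serre1977, §2.6] -/
theorem slotExt_comp_apply_translate {A : Submodule ℚ (Y → ℚ)} [DecidableEq S]
    (ι : ∀ s, Jf s → ((Y → ℚ) →ₗ[ℚ] (Yf s → ℚ)))
    (hιeq : ∀ s (j : Jf s) (k : G) (a : Y → ℚ), a ∈ A → ι s j (fun y => a (k • y)) = fun y => ι s j a (k • y))
    (p : Σ s, Jf s) (k : G) (a : Y → ℚ) (ha : a ∈ A) :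
    (slotExt p.1 ∘ₗ ι p.1 p.2) (fun y => a (k • y)) = fun z => (slotExt p.1 ∘ₗ ι p.1 p.2) a (k • z) := by
  obtain ⟨s, j⟩ := p
  rw [LinearMap.comp_apply, hιeq s j k a ha]
  funext z
  obtain ⟨t, y⟩ := z
  rw [LinearMap.comp_apply, Sigma.smul_mk]
  by_cases hts : t = s
  · subst hts
    rw [slotExt_apply_same, slotExt_apply_same]
  · rw [slotExt_apply_of_ne hts, slotExt_apply_of_ne hts]

omit [Fintype Y] [MulAction G Y] [∀ s, MulAction G (Yf s)] [∀ s, Fintype (Yf s)] in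
/-- The combined sum is the assembly of the slot sums: `Σ_{(s,j)} slotExt s (ι^s_j f_{s,j}) = sigmaLift (s ↦ Σ_j ι^s_j
f_{s,j})`. [cite: Serre1977, §2.6] -/
theorem sum_sigma_slotExt_comp_apply [DecidableEq S] (ι : ∀ s, Jf s → ((Y → ℚ) →ₗ[ℚ] (Yf s → ℚ)))
    (f : (Σ s, Jf s) → (Y → ℚ)) :
    ∑ p : Σ s, Jf s, (slotExt p.1 ∘ₗ ι p.1 p.2) (f p) = sigmaLift fun s => ∑ j, ι s j (f ⟨s, j⟩) := by
  rw [sigmaLift_eq_sum_slotExt, Fintype.sum_sigma]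
  refine Finset.sum_congr rfl fun s _ => ?_
  rw [map_sum]
  rfl

omit [Fintype Y] [MulAction G Y] [∀ s, MulAction G (Yf s)] [∀ s, Fintype (Yf s)] in
/-- **JOINT INDEPENDENCE ON THE DISJOINT UNION**: if each family `(ι^s_j)_j` is jointly independent on `A`, so is the
combined family `((s, j) ↦ slotExt s ∘ ι^s_j)` (read the vanishing slot by slot). [cite: Serre1977, §2.6] -/
theorem sigma_jointly_independent {A : Submodule ℚ (Y → ℚ)} [DecidableEq S]
    (ι : ∀ s, Jf s → ((Y → ℚ) →ₗ[ℚ] (Yf s → ℚ)))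
    (hind : ∀ s (f : Jf s → (Y → ℚ)), (∀ j, f j ∈ A) → ∑ j, ι s j (f j) = 0 → ∀ j, f j = 0)
    (f : (Σ s, Jf s) → (Y → ℚ)) (hf : ∀ p, f p ∈ A) (h0 : ∑ p : Σ s, Jf s, (slotExt p.1 ∘ₗ ι p.1 p.2) (f p) = 0)
    (p : Σ s, Jf s) : f p = 0 := by
  obtain ⟨s, j⟩ := p
  rw [sum_sigma_slotExt_comp_apply] at h0
  have hs : ∑ j, ι s j (f ⟨s, j⟩) = 0 := by
    funext y
    have h := congrFun h0 ⟨s, y⟩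
    rw [sigmaLift_apply] at h
    exact h
  exact hind s (fun j => f ⟨s, j⟩) (fun j => hf _) hs j

omit [Fintype Y] [MulAction G Y] [Fintype S] [∀ s, Fintype (Yf s)] in
/-- **`S(⊔_s w_s) = ⨆_s S(w_s)`**: the shadow-coefficient space of a juxtaposed vector on `⊔_s Y_s` is the SUM of the
shadow-coefficient spaces of its slots, all inside the one space `ℚ^G` (any vectors `w_s`). [cite: Serre1977, §2.6]
[cite: Gordon1999HodgeAVSurvey, §3 Theorem (proof)] -/
theorem span_shadowCoeff_sigmaLift_eq_iSup (w : ∀ s, Yf s → ℚ) :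
    Submodule.span ℚ (Set.range fun z : (Σ s, Yf s) => fun g : G => sigmaLift w (g • z)) =
      ⨆ s, Submodule.span ℚ (Set.range fun y : Yf s => fun g : G => w s (g • y)) := by
  rw [← Submodule.span_iUnion]
  congr 1
  ext c
  simp only [Set.mem_range, Set.mem_iUnion]
  constructor
  · rintro ⟨⟨s, y⟩, rfl⟩
    exact ⟨s, y, funext fun g => by rw [Sigma.smul_mk, sigmaLift_apply]⟩
  · rintro ⟨s, y, rfl⟩
    exact ⟨⟨s, y⟩, funext fun g => by rw [Sigma.smul_mk, sigmaLift_apply]⟩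

omit [Fintype S] [∀ s, Fintype (Jf s)] in
/-- `D⟨(b^s_j)_{(s,j)}⟩ = ⨆_s D⟨b^s⟩` (re-bracketing a `⨆` over a `Σ`-type). [cite: Lang2002, XVII §1] -/
theorem iSup_sigma_map_applyₗ {V : Type v} [AddCommGroup V] [Module ℚ V] (𝒟 : Submodule ℚ (V →ₗ[ℚ] V))
    (b : ∀ s, Jf s → V) :
    (⨆ p : Σ s, Jf s, 𝒟.map (LinearMap.applyₗ (b p.1 p.2))) = ⨆ s, ⨆ j, 𝒟.map (LinearMap.applyₗ (b s j)) := by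
  rw [iSup_sigma]

/-! ### §2 Counts for a family of pivots -/

/-- **`dim(⨆_s S(w_s))·δ = dim(⨆_s D⟨b^s⟩)·dim A`** for `A` stable irreducible with ANY commutant and a finite family
of pivots (file C4 §1 on the disjoint-union pivot). [cite: Lang2002, XVII §3] [cite: Serre1977, §2.6] -/
theorem finrank_iSup_span_shadowCoeff_mul_eq {A : Submodule ℚ (Y → ℚ)} {𝒟 : Submodule ℚ ((Y → ℚ) →ₗ[ℚ] (Y → ℚ))}
    (h𝒟 : ∀ L : (Y → ℚ) →ₗ[ℚ] (Y → ℚ), L ∈ 𝒟 ↔ (∀ a ∈ A, L a ∈ A) ∧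
      ∀ (k : G) (a : Y → ℚ), a ∈ A → L (fun y => a (k • y)) = fun y => L a (k • y))
    (hAst : ∀ (k : G) (a : Y → ℚ), a ∈ A → (fun y => a (k • y)) ∈ A)
    (hAirr : ∀ W : Submodule ℚ (Y → ℚ), W ≤ A → W ≠ ⊥ →
      (∀ (k : G) (f : Y → ℚ), f ∈ W → (fun y => f (k • y)) ∈ W) → W = A)
    (ι : ∀ s, Jf s → ((Y → ℚ) →ₗ[ℚ] (Yf s → ℚ)))
    (hιeq : ∀ s (j : Jf s) (k : G) (a : Y → ℚ), a ∈ A → ι s j (fun y => a (k • y)) = fun y => ι s j a (k • y))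
    (hind : ∀ s (f : Jf s → (Y → ℚ)), (∀ j, f j ∈ A) → ∑ j, ι s j (f j) = 0 → ∀ j, f j = 0)
    {b : ∀ s, Jf s → (Y → ℚ)} (hb : ∀ s j, b s j ∈ A) {a₀ : Y → ℚ} (ha₀ : a₀ ∈ A) (h0 : a₀ ≠ 0) :
    Module.finrank ℚ ↥(⨆ s, Submodule.span ℚ (Set.range fun y : Yf s => fun g : G => (∑ j, ι s j (b s j)) (g • y))) *
        Module.finrank ℚ ↥(𝒟.map (LinearMap.applyₗ a₀)) =
      Module.finrank ℚ ↥(⨆ s, ⨆ j, 𝒟.map (LinearMap.applyₗ (b s j))) * Module.finrank ℚ A := by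
  have h := finrank_span_shadowCoeff_sum_mul_eq (Y₀ := Σ s, Yf s) (J := Σ s, Jf s) h𝒟 hAst hAirr
    (fun p => slotExt p.1 ∘ₗ ι p.1 p.2) (fun p k a ha => slotExt_comp_apply_translate ι hιeq p k a ha)
    (fun f hf hf0 p => sigma_jointly_independent ι hind f hf hf0 p) (b := fun p => b p.1 p.2) (fun p => hb p.1 p.2)
    ha₀ h0
  rw [sum_sigma_slotExt_comp_apply, span_shadowCoeff_sigmaLift_eq_iSup, iSup_sigma_map_applyₗ] at h
  exact h

/-- **THE D-RANK OF A FAMILY OF SHADOWS**: there is `r ≤ Σ_s |J_s|` with **`dim ⨆_s D⟨b^s⟩ = r·δ` and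
`dim ⨆_s S(w_s) = r·dim A`**. [cite: Lang2002, XVII §3] [cite: Serre1977, §2.6] -/
theorem exists_rank_finrank_iSup_span_shadowCoeff_eq {A : Submodule ℚ (Y → ℚ)}
    {𝒟 : Submodule ℚ ((Y → ℚ) →ₗ[ℚ] (Y → ℚ))}
    (h𝒟 : ∀ L : (Y → ℚ) →ₗ[ℚ] (Y → ℚ), L ∈ 𝒟 ↔ (∀ a ∈ A, L a ∈ A) ∧
      ∀ (k : G) (a : Y → ℚ), a ∈ A → L (fun y => a (k • y)) = fun y => L a (k • y))
    (hAst : ∀ (k : G) (a : Y → ℚ), a ∈ A → (fun y => a (k • y)) ∈ A)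
    (hAirr : ∀ W : Submodule ℚ (Y → ℚ), W ≤ A → W ≠ ⊥ →
      (∀ (k : G) (f : Y → ℚ), f ∈ W → (fun y => f (k • y)) ∈ W) → W = A)
    (ι : ∀ s, Jf s → ((Y → ℚ) →ₗ[ℚ] (Yf s → ℚ)))
    (hιeq : ∀ s (j : Jf s) (k : G) (a : Y → ℚ), a ∈ A → ι s j (fun y => a (k • y)) = fun y => ι s j a (k • y))
    (hind : ∀ s (f : Jf s → (Y → ℚ)), (∀ j, f j ∈ A) → ∑ j, ι s j (f j) = 0 → ∀ j, f j = 0)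
    {b : ∀ s, Jf s → (Y → ℚ)} (hb : ∀ s j, b s j ∈ A) {a₀ : Y → ℚ} (ha₀ : a₀ ∈ A) (h0 : a₀ ≠ 0) :
    ∃ r : ℕ, r ≤ ∑ s, Fintype.card (Jf s) ∧
      Module.finrank ℚ ↥(⨆ s, ⨆ j, 𝒟.map (LinearMap.applyₗ (b s j))) =
        r * Module.finrank ℚ ↥(𝒟.map (LinearMap.applyₗ a₀)) ∧
      Module.finrank ℚ
          ↥(⨆ s, Submodule.span ℚ (Set.range fun y : Yf s => fun g : G => (∑ j, ι s j (b s j)) (g • y))) =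
        r * Module.finrank ℚ A := by
  obtain ⟨r, hr, hD, hS⟩ := exists_rank_finrank_span_shadowCoeff_sum_eq (Y₀ := Σ s, Yf s) (J := Σ s, Jf s) h𝒟 hAst
    hAirr (fun p => slotExt p.1 ∘ₗ ι p.1 p.2) (fun p k a ha => slotExt_comp_apply_translate ι hιeq p k a ha)
    (fun f hf hf0 p => sigma_jointly_independent ι hind f hf hf0 p) (b := fun p => b p.1 p.2) (fun p => hb p.1 p.2)
    ha₀ h0
  rw [sum_sigma_slotExt_comp_apply, span_shadowCoeff_sigmaLift_eq_iSup] at hS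
  rw [iSup_sigma_map_applyₗ] at hD
  rw [Fintype.card_sigma] at hr
  exact ⟨r, hr, hD, hS⟩

/-- **A FAMILY AGAINST ONE MORE PIVOT: `dim((⨆_s S(w_s)) ∩ S(w′))·δ = dim((⨆_s D⟨b^s⟩) ∩ D⟨b′⟩)·dim A`** (file C4 §2
with the disjoint-union pivot on the left). [cite: Lang2002, XVII §3] [cite: Serre1977, §2.6]
[cite: Gordon1999HodgeAVSurvey, §3 Theorem (proof), 7.5–7.7] -/
theorem finrank_iSup_span_shadowCoeff_inf_mul_eq {A : Submodule ℚ (Y → ℚ)}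
    {𝒟 : Submodule ℚ ((Y → ℚ) →ₗ[ℚ] (Y → ℚ))}
    (h𝒟 : ∀ L : (Y → ℚ) →ₗ[ℚ] (Y → ℚ), L ∈ 𝒟 ↔ (∀ a ∈ A, L a ∈ A) ∧
      ∀ (k : G) (a : Y → ℚ), a ∈ A → L (fun y => a (k • y)) = fun y => L a (k • y))
    (hAst : ∀ (k : G) (a : Y → ℚ), a ∈ A → (fun y => a (k • y)) ∈ A)
    (hAirr : ∀ W : Submodule ℚ (Y → ℚ), W ≤ A → W ≠ ⊥ →
      (∀ (k : G) (f : Y → ℚ), f ∈ W → (fun y => f (k • y)) ∈ W) → W = A)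
    (ι : ∀ s, Jf s → ((Y → ℚ) →ₗ[ℚ] (Yf s → ℚ))) {J₁ : Type u'} [Fintype J₁]
    (ι₁ : J₁ → ((Y → ℚ) →ₗ[ℚ] (Y₁ → ℚ)))
    (hιeq : ∀ s (j : Jf s) (k : G) (a : Y → ℚ), a ∈ A → ι s j (fun y => a (k • y)) = fun y => ι s j a (k • y))
    (hι₁eq : ∀ (j : J₁) (k : G) (a : Y → ℚ), a ∈ A → ι₁ j (fun y => a (k • y)) = fun y => ι₁ j a (k • y))
    (hind : ∀ s (f : Jf s → (Y → ℚ)), (∀ j, f j ∈ A) → ∑ j, ι s j (f j) = 0 → ∀ j, f j = 0)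
    (hind₁ : ∀ f : J₁ → (Y → ℚ), (∀ j, f j ∈ A) → ∑ j, ι₁ j (f j) = 0 → ∀ j, f j = 0)
    {b : ∀ s, Jf s → (Y → ℚ)} {b₁ : J₁ → (Y → ℚ)} (hb : ∀ s j, b s j ∈ A) (hb₁ : ∀ j, b₁ j ∈ A)
    {a₀ : Y → ℚ} (ha₀ : a₀ ∈ A) (h0 : a₀ ≠ 0) :
    Module.finrank ℚ
          ↥((⨆ s, Submodule.span ℚ (Set.range fun y : Yf s => fun g : G => (∑ j, ι s j (b s j)) (g • y))) ⊓
            Submodule.span ℚ (Set.range fun y : Y₁ => fun g : G => (∑ j, ι₁ j (b₁ j)) (g • y))) *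
        Module.finrank ℚ ↥(𝒟.map (LinearMap.applyₗ a₀)) =
      Module.finrank ℚ ↥((⨆ s, ⨆ j, 𝒟.map (LinearMap.applyₗ (b s j))) ⊓ ⨆ j, 𝒟.map (LinearMap.applyₗ (b₁ j))) *
        Module.finrank ℚ A := by
  have h := finrank_span_shadowCoeff_inf_mul_eq (Y₀ := Σ s, Yf s) (J₀ := Σ s, Jf s) h𝒟 hAst hAirr
    (fun p => slotExt p.1 ∘ₗ ι p.1 p.2) ι₁ (fun p k a ha => slotExt_comp_apply_translate ι hιeq p k a ha) hι₁eq
    (fun f hf hf0 p => sigma_jointly_independent ι hind f hf hf0 p) hind₁ (b₀ := fun p => b p.1 p.2)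
    (fun p => hb p.1 p.2) hb₁ ha₀ h0
  rw [sum_sigma_slotExt_comp_apply, span_shadowCoeff_sigmaLift_eq_iSup, iSup_sigma_map_applyₗ] at h
  exact h

/-- **`(⨆_s S(w_s)) ∩ S(w′) = 0 ⟺ (⨆_s D⟨b^s⟩) ∩ D⟨b′⟩ = 0`** (`A ≠ 0`): the new pivot is ADDITIVE against the whole
family iff its D-span meets the family's D-span trivially. [cite: Lang2002, XVII §3] [cite: Serre1977, §2.6] -/
theorem iSup_span_shadowCoeff_inf_eq_bot_iff {A : Submodule ℚ (Y → ℚ)} {𝒟 : Submodule ℚ ((Y → ℚ) →ₗ[ℚ] (Y → ℚ))}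
    (h𝒟 : ∀ L : (Y → ℚ) →ₗ[ℚ] (Y → ℚ), L ∈ 𝒟 ↔ (∀ a ∈ A, L a ∈ A) ∧
      ∀ (k : G) (a : Y → ℚ), a ∈ A → L (fun y => a (k • y)) = fun y => L a (k • y))
    (hAst : ∀ (k : G) (a : Y → ℚ), a ∈ A → (fun y => a (k • y)) ∈ A)
    (hAirr : ∀ W : Submodule ℚ (Y → ℚ), W ≤ A → W ≠ ⊥ →
      (∀ (k : G) (f : Y → ℚ), f ∈ W → (fun y => f (k • y)) ∈ W) → W = A)
    (hA0 : A ≠ ⊥) (ι : ∀ s, Jf s → ((Y → ℚ) →ₗ[ℚ] (Yf s → ℚ))) {J₁ : Type u'} [Fintype J₁]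
    (ι₁ : J₁ → ((Y → ℚ) →ₗ[ℚ] (Y₁ → ℚ)))
    (hιeq : ∀ s (j : Jf s) (k : G) (a : Y → ℚ), a ∈ A → ι s j (fun y => a (k • y)) = fun y => ι s j a (k • y))
    (hι₁eq : ∀ (j : J₁) (k : G) (a : Y → ℚ), a ∈ A → ι₁ j (fun y => a (k • y)) = fun y => ι₁ j a (k • y))
    (hind : ∀ s (f : Jf s → (Y → ℚ)), (∀ j, f j ∈ A) → ∑ j, ι s j (f j) = 0 → ∀ j, f j = 0)
    (hind₁ : ∀ f : J₁ → (Y → ℚ), (∀ j, f j ∈ A) → ∑ j, ι₁ j (f j) = 0 → ∀ j, f j = 0)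
    {b : ∀ s, Jf s → (Y → ℚ)} {b₁ : J₁ → (Y → ℚ)} (hb : ∀ s j, b s j ∈ A) (hb₁ : ∀ j, b₁ j ∈ A) :
    (⨆ s, Submodule.span ℚ (Set.range fun y : Yf s => fun g : G => (∑ j, ι s j (b s j)) (g • y))) ⊓
          Submodule.span ℚ (Set.range fun y : Y₁ => fun g : G => (∑ j, ι₁ j (b₁ j)) (g • y)) = ⊥ ↔
      (⨆ s, ⨆ j, 𝒟.map (LinearMap.applyₗ (b s j))) ⊓ (⨆ j, 𝒟.map (LinearMap.applyₗ (b₁ j))) = ⊥ := by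
  have h := span_shadowCoeff_inf_eq_bot_iff_iSup (Y₀ := Σ s, Yf s) (J₀ := Σ s, Jf s) h𝒟 hAst hAirr hA0
    (fun p => slotExt p.1 ∘ₗ ι p.1 p.2) ι₁ (fun p k a ha => slotExt_comp_apply_translate ι hιeq p k a ha) hι₁eq
    (fun f hf hf0 p => sigma_jointly_independent ι hind f hf hf0 p) hind₁ (b₀ := fun p => b p.1 p.2)
    (fun p => hb p.1 p.2) hb₁
  rw [sum_sigma_slotExt_comp_apply, span_shadowCoeff_sigmaLift_eq_iSup, iSup_sigma_map_applyₗ] at h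
  exact h

/-! ### §3 Absorption by a family -/

/-- **ABSORPTION BY A FAMILY OF PIVOTS: `S(w′) ≤ ⨆_s S(w_s) ⟺ D⟨b′⟩ ≤ ⨆_s D⟨b^s⟩`** (`A ≠ 0` stable irreducible with
ANY commutant): the shadow `w′` is absorbed by the shadows `w_s` iff every component `b′_k` is a `D`-combination of
ALL the components `b^s_j` (file C6 on the disjoint-union pivot). [cite: Lang2002, XVII §3] [cite: Serre1977, §2.6]
[cite: Gordon1999HodgeAVSurvey, §3 Theorem (proof), 7.5–7.7] -/
theorem span_shadowCoeff_le_iSup_iff_iSup_le {A : Submodule ℚ (Y → ℚ)} {𝒟 : Submodule ℚ ((Y → ℚ) →ₗ[ℚ] (Y → ℚ))}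
    (h𝒟 : ∀ L : (Y → ℚ) →ₗ[ℚ] (Y → ℚ), L ∈ 𝒟 ↔ (∀ a ∈ A, L a ∈ A) ∧
      ∀ (k : G) (a : Y → ℚ), a ∈ A → L (fun y => a (k • y)) = fun y => L a (k • y))
    (hAst : ∀ (k : G) (a : Y → ℚ), a ∈ A → (fun y => a (k • y)) ∈ A)
    (hAirr : ∀ W : Submodule ℚ (Y → ℚ), W ≤ A → W ≠ ⊥ →
      (∀ (k : G) (f : Y → ℚ), f ∈ W → (fun y => f (k • y)) ∈ W) → W = A)
    (hA0 : A ≠ ⊥) (ι : ∀ s, Jf s → ((Y → ℚ) →ₗ[ℚ] (Yf s → ℚ))) {J₁ : Type u'} [Fintype J₁]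
    (ι₁ : J₁ → ((Y → ℚ) →ₗ[ℚ] (Y₁ → ℚ)))
    (hιeq : ∀ s (j : Jf s) (k : G) (a : Y → ℚ), a ∈ A → ι s j (fun y => a (k • y)) = fun y => ι s j a (k • y))
    (hι₁eq : ∀ (j : J₁) (k : G) (a : Y → ℚ), a ∈ A → ι₁ j (fun y => a (k • y)) = fun y => ι₁ j a (k • y))
    (hind : ∀ s (f : Jf s → (Y → ℚ)), (∀ j, f j ∈ A) → ∑ j, ι s j (f j) = 0 → ∀ j, f j = 0)
    (hind₁ : ∀ f : J₁ → (Y → ℚ), (∀ j, f j ∈ A) → ∑ j, ι₁ j (f j) = 0 → ∀ j, f j = 0)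
    {b : ∀ s, Jf s → (Y → ℚ)} {b₁ : J₁ → (Y → ℚ)} (hb : ∀ s j, b s j ∈ A) (hb₁ : ∀ j, b₁ j ∈ A) :
    Submodule.span ℚ (Set.range fun y : Y₁ => fun g : G => (∑ j, ι₁ j (b₁ j)) (g • y)) ≤
        (⨆ s, Submodule.span ℚ (Set.range fun y : Yf s => fun g : G => (∑ j, ι s j (b s j)) (g • y))) ↔
      (⨆ j, 𝒟.map (LinearMap.applyₗ (b₁ j))) ≤ ⨆ s, ⨆ j, 𝒟.map (LinearMap.applyₗ (b s j)) := by
  have h := span_shadowCoeff_le_iff_iSup_le (Y₀ := Σ s, Yf s) (J₀ := Σ s, Jf s) h𝒟 hAst hAirr hA0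
    (fun p => slotExt p.1 ∘ₗ ι p.1 p.2) ι₁ (fun p k a ha => slotExt_comp_apply_translate ι hιeq p k a ha) hι₁eq
    (fun f hf hf0 p => sigma_jointly_independent ι hind f hf hf0 p) hind₁ (b₀ := fun p => b p.1 p.2)
    (fun p => hb p.1 p.2) hb₁
  rw [sum_sigma_slotExt_comp_apply, span_shadowCoeff_sigmaLift_eq_iSup, iSup_sigma_map_applyₗ] at h
  exact h

/-- **FAMILY AGAINST FAMILY: `⨆_t S(w′_t) ≤ ⨆_s S(w_s) ⟺ ⨆_t D⟨b′^t⟩ ≤ ⨆_s D⟨b^s⟩`** (`A ≠ 0`; a second finite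
family of pivots `Y′_t`, `t ∈ S′`). [cite: Lang2002, XVII §3] [cite: Serre1977, §2.6] -/
theorem iSup_span_shadowCoeff_le_iSup_iff {A : Submodule ℚ (Y → ℚ)} {𝒟 : Submodule ℚ ((Y → ℚ) →ₗ[ℚ] (Y → ℚ))}
    (h𝒟 : ∀ L : (Y → ℚ) →ₗ[ℚ] (Y → ℚ), L ∈ 𝒟 ↔ (∀ a ∈ A, L a ∈ A) ∧
      ∀ (k : G) (a : Y → ℚ), a ∈ A → L (fun y => a (k • y)) = fun y => L a (k • y))
    (hAst : ∀ (k : G) (a : Y → ℚ), a ∈ A → (fun y => a (k • y)) ∈ A)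
    (hAirr : ∀ W : Submodule ℚ (Y → ℚ), W ≤ A → W ≠ ⊥ →
      (∀ (k : G) (f : Y → ℚ), f ∈ W → (fun y => f (k • y)) ∈ W) → W = A)
    (hA0 : A ≠ ⊥) (ι : ∀ s, Jf s → ((Y → ℚ) →ₗ[ℚ] (Yf s → ℚ)))
    {S' : Type uS} [Fintype S'] {Yf' : S' → Type v''} [∀ t, MulAction G (Yf' t)] [∀ t, Fintype (Yf' t)]
    {Jf' : S' → Type u'} [∀ t, Fintype (Jf' t)] (ι' : ∀ t, Jf' t → ((Y → ℚ) →ₗ[ℚ] (Yf' t → ℚ)))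
    (hιeq : ∀ s (j : Jf s) (k : G) (a : Y → ℚ), a ∈ A → ι s j (fun y => a (k • y)) = fun y => ι s j a (k • y))
    (hι'eq : ∀ t (j : Jf' t) (k : G) (a : Y → ℚ), a ∈ A → ι' t j (fun y => a (k • y)) = fun y => ι' t j a (k • y))
    (hind : ∀ s (f : Jf s → (Y → ℚ)), (∀ j, f j ∈ A) → ∑ j, ι s j (f j) = 0 → ∀ j, f j = 0)
    (hind' : ∀ t (f : Jf' t → (Y → ℚ)), (∀ j, f j ∈ A) → ∑ j, ι' t j (f j) = 0 → ∀ j, f j = 0)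
    {b : ∀ s, Jf s → (Y → ℚ)} {b' : ∀ t, Jf' t → (Y → ℚ)} (hb : ∀ s j, b s j ∈ A) (hb' : ∀ t j, b' t j ∈ A) :
    (⨆ t, Submodule.span ℚ (Set.range fun y : Yf' t => fun g : G => (∑ j, ι' t j (b' t j)) (g • y))) ≤
        (⨆ s, Submodule.span ℚ (Set.range fun y : Yf s => fun g : G => (∑ j, ι s j (b s j)) (g • y))) ↔
      (⨆ t, ⨆ j, 𝒟.map (LinearMap.applyₗ (b' t j))) ≤ ⨆ s, ⨆ j, 𝒟.map (LinearMap.applyₗ (b s j)) := by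
  rw [iSup_le_iff, iSup_le_iff]
  exact forall_congr' fun t => span_shadowCoeff_le_iSup_iff_iSup_le h𝒟 hAst hAirr hA0 ι (ι' t) hιeq (hι'eq t) hind
    (hind' t) hb (hb' t)

/-- **`⨆_t S(w′_t) = ⨆_s S(w_s) ⟺ ⨆_t D⟨b′^t⟩ = ⨆_s D⟨b^s⟩`** — two families of shadows have the same coefficient
space iff their components have the same D-span. [cite: Lang2002, XVII §3] [cite: Serre1977, §2.6] -/
theorem iSup_span_shadowCoeff_eq_iSup_iff {A : Submodule ℚ (Y → ℚ)} {𝒟 : Submodule ℚ ((Y → ℚ) →ₗ[ℚ] (Y → ℚ))}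
    (h𝒟 : ∀ L : (Y → ℚ) →ₗ[ℚ] (Y → ℚ), L ∈ 𝒟 ↔ (∀ a ∈ A, L a ∈ A) ∧
      ∀ (k : G) (a : Y → ℚ), a ∈ A → L (fun y => a (k • y)) = fun y => L a (k • y))
    (hAst : ∀ (k : G) (a : Y → ℚ), a ∈ A → (fun y => a (k • y)) ∈ A)
    (hAirr : ∀ W : Submodule ℚ (Y → ℚ), W ≤ A → W ≠ ⊥ →
      (∀ (k : G) (f : Y → ℚ), f ∈ W → (fun y => f (k • y)) ∈ W) → W = A)
    (hA0 : A ≠ ⊥) (ι : ∀ s, Jf s → ((Y → ℚ) →ₗ[ℚ] (Yf s → ℚ)))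
    {S' : Type uS} [Fintype S'] {Yf' : S' → Type v''} [∀ t, MulAction G (Yf' t)] [∀ t, Fintype (Yf' t)]
    {Jf' : S' → Type u'} [∀ t, Fintype (Jf' t)] (ι' : ∀ t, Jf' t → ((Y → ℚ) →ₗ[ℚ] (Yf' t → ℚ)))
    (hιeq : ∀ s (j : Jf s) (k : G) (a : Y → ℚ), a ∈ A → ι s j (fun y => a (k • y)) = fun y => ι s j a (k • y))
    (hι'eq : ∀ t (j : Jf' t) (k : G) (a : Y → ℚ), a ∈ A → ι' t j (fun y => a (k • y)) = fun y => ι' t j a (k • y))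
    (hind : ∀ s (f : Jf s → (Y → ℚ)), (∀ j, f j ∈ A) → ∑ j, ι s j (f j) = 0 → ∀ j, f j = 0)
    (hind' : ∀ t (f : Jf' t → (Y → ℚ)), (∀ j, f j ∈ A) → ∑ j, ι' t j (f j) = 0 → ∀ j, f j = 0)
    {b : ∀ s, Jf s → (Y → ℚ)} {b' : ∀ t, Jf' t → (Y → ℚ)} (hb : ∀ s j, b s j ∈ A) (hb' : ∀ t j, b' t j ∈ A) :
    (⨆ t, Submodule.span ℚ (Set.range fun y : Yf' t => fun g : G => (∑ j, ι' t j (b' t j)) (g • y))) =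
        (⨆ s, Submodule.span ℚ (Set.range fun y : Yf s => fun g : G => (∑ j, ι s j (b s j)) (g • y))) ↔
      (⨆ t, ⨆ j, 𝒟.map (LinearMap.applyₗ (b' t j))) = ⨆ s, ⨆ j, 𝒟.map (LinearMap.applyₗ (b s j)) := by
  rw [le_antisymm_iff, le_antisymm_iff,
    iSup_span_shadowCoeff_le_iSup_iff h𝒟 hAst hAirr hA0 ι ι' hιeq hι'eq hind hind' hb hb',
    iSup_span_shadowCoeff_le_iSup_iff h𝒟 hAst hAirr hA0 ι' ι hι'eq hιeq hind' hind hb' hb]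

end Summit.HodgeConjecture.CorCM.IrrOdd

end
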